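import Mathlib
import Literature.Combinatorics.Optimization.NonnegativeRankJuntaDegree
import Literature.Analysis.Quadrature.AnovaDecomposition
import HarnessLib

/-!
# Sherali–Adams solutions from consistent local distributions over a general alphabet
# (Charikar–Makarychev–Makarychev Lemma 2.1 / Chan–Lee–Raghavendra–Steurer §2.1 and §3.5), in the
# `d`-local pseudo-density currency of Lee–Raghavendra–Steurer §7.1 — PROVED

[topic Combinatorics/Optimization]

General-alphabet companion of `SheraliAdamsLocalDistributions.lean` (which treats `{0,1}ⁿ` by Walsh
expansion).  The printed Sherali–Adams gap constructions over a label set `[q]` — Charikar–Makarychev–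
Makarychev's Unique Games gap (STOC 2009, Thm 6.1: "it is enough to prove that for every set of vertices
`S` of size at most `O(r)` there exists a distribution of integral solutions `D_S` such that (i) `x_u(i)`
is the probability that `u` has label `i` …; (ii) for every two sets `S ⊂ T` the distributions `D_S` and
`D_T` coincide on `S`", p. 13), Benabbas–Georgiou–Magen–Tulsiani over `[q]` — produce CONSISTENT LOCAL
DISTRIBUTIONS; the consumers in the tree (Lee–Raghavendra–Steurer Thm 7.2/7.6,
`NonnegativeRankJuntaDegree.lean`, `UniqueGamesLpHardness.lean`) speak of `d`-LOCAL PSEUDO-DENSITIES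
w.r.t. the uniform measure on `Xⁿ` (`IsLocalPseudoDensity`, LRS §7.1 p. 27: "`E_μ D = 1` and
`E_{x∼μ} D(x) g(x) ≥ 0` for all nonnegative `d`-juntas `g`").  Lee–Raghavendra–Steurer (Thm 7.6, p. 29):
"there is an equivalence between such lower bounds and the existence of a `d`-local pseudo-density; we
refer to [ChanLRS13] for a discussion"; Chan–Lee–Raghavendra–Steurer §2.1 (arXiv v3 p. 8): "for every
set `S ⊆ [n]` with `|S| ≤ d` there exists a distribution `μ_S` over `{±1}^S` such that
`E_{x∼μ_S} χ_A(x) = X_A` … In an alternate but equivalent terminology, a `d`-round SA instance can be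
thought of as `d`-local expectation functional … we can extend it linearly to all of `L²({−1,1}ⁿ)`",
and §3.5 (p. 11): "Extension to non-Boolean CSPs".

This file PROVES the direction used by every consumer, over an ARBITRARY finite alphabet `X` and
finite index set `ι`: **a consistent family of local distributions on the sets `T ⊆ ι` with `|T| ≤ d`
yields a `d`-local pseudo-density `D` (w.r.t. the uniform measure on `X^ι`) whose integral against
every `T`-junta `g`, `|T| ≤ d`, is the local expectation `E_{D_T} g`**
(`LocalExpectationsOn.isLocalPseudoDensity_density`, `LocalExpectationsOn.muExpect_density_mul_of_isSJunta`).
In place of the Walsh expansion of the Boolean file the construction uses the Möbius / ANOVA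
decomposition over a general alphabet (Efron–Stein; the tree's `Literature.Analysis.Quadrature.Anova`,
whose `glue` is reused): with `A_R f(x) = E_y f(x_R, y_{−R})` (average out the coordinates outside `R`)
and the component `f^{(S)} = Σ_{R ⊆ S} (−1)^{|S∖R|} A_R f`, one has `Σ_{S ⊆ T} f^{(S)} = A_T f` (Möbius
inversion) and `f^{(S)} = 0` whenever `f` is a `T`-junta and `S ⊄ T`; the functional
`Ẽ f = Σ_{|S| ≤ d} L_S(f^{(S)}|_S)` therefore satisfies `Ẽ g = L_T(g|_T)` for every `T`-junta `g`,
`|T| ≤ d` (consistency moves each `L_S`, `S ⊆ T`, up to `L_T`), and `D(x) = |X^ι| · Ẽ(𝟙_x)` is the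
pseudo-density.  Everything is proved (finite sums); no named facts; no `sorry`.

Declarations: `LocalExpectationsOn ι X d` (the data: positive normalised linear functionals
`L_T : (X^T → ℝ) → ℝ`, consistent under restriction for `Q ⊆ T`, `|T| ≤ d`), `avgOut` (`A_R`),
`moebiusPart` (`f^{(S)}`), `extendWith` (a local assignment extended by a default letter),
`LocalExpectationsOn.saE` (`Ẽ`), `LocalExpectationsOn.density` (`D`); theorems `isSJunta_avgOut`,
`avgOut_eq_self`, `avgOut_insert`, `moebiusPart_insert_eq_zero`, `moebiusPart_eq_zero`,
`sum_powerset_moebiusPart`, `isSJunta_moebiusPart`, `LocalExpectationsOn.saE_eq_of_isSJunta`,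
`LocalExpectationsOn.muExpect_density_mul`, `LocalExpectationsOn.muExpect_density_mul_of_isSJunta`,
`LocalExpectationsOn.isLocalPseudoDensity_density`.

## References

* [CharikarMakarychevMakarychev2009] M. Charikar, K. Makarychev, Y. Makarychev, *Integrality gaps for
  Sherali–Adams relaxations*, STOC 2009, doi:10.1145/1536414.1536455; Lemma 2.1 (p. 4–5), §6 (p. 13).
  Held text `paper:doi-10-1145-1536414-1536455`.
* [ChanEtAl2016] S. O. Chan, J. R. Lee, P. Raghavendra, D. Steurer, *Approximate constraint satisfaction
  requires large LP relaxations*, FOCS 2013 / J. ACM 63 (2016); §2.1 (arXiv v3 p. 8), §3.5 (p. 11).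
  Held text `paper:arxiv-1309.0563`.
* [LeeRaghavendraSteurer2015] J. R. Lee, P. Raghavendra, D. Steurer, *Lower bounds on the size of
  semidefinite programming relaxations*, STOC 2015, arXiv:1411.6317; §7.1 (p. 27), Thm 7.6 (p. 29).
* [Lemieux2009] C. Lemieux, *Monte Carlo and Quasi-Monte Carlo Sampling*, Springer 2009, §6.3 (the
  ANOVA / Möbius decomposition; tree file `Literature/Analysis/Quadrature/AnovaDecomposition.lean`).
-/

noncomputable section

open Finset
open Literature.Analysis.Quadrature.Anova (glue glue_apply_of_mem glue_apply_of_notMem)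

namespace Literature.Combinatorics.Optimization

/-! ### Consistent local distributions over the alphabet `X` -/

/-- **Consistent local distributions up to level `d` over a finite alphabet `X`** (the hypothesis of
CMM Lemma 2.1 / the data of CMM Thm 6.1's proof, p. 13), one for every `T ⊆ ι`, carried as the
expectation functionals `L_T : (X^T → ℝ) → ℝ` of the distributions `D_T`: linear, nonnegative on
nonnegative functions, `L_T 1 = 1`, and CONSISTENT — for `Q ⊆ T` the push-forward of `D_T` under
restriction `X^T → X^Q` is `D_Q` ("for every two sets `S ⊂ T` the distributions `D_S` and `D_T`
coincide on `S`").  Only the sets with `|T| ≤ d` are constrained.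
[cite: CharikarMakarychevMakarychev2009, Lemma 2.1 (p. 4–5) and §6 (p. 13)]
[cite: ChanEtAl2016, §2.1 (arXiv v3 p. 8) and §3.5 (p. 11)] -/
structure LocalExpectationsOn (ι X : Type*) [DecidableEq ι] (d : ℕ) where
  /-- the expectation functional of the local distribution on `X^T` -/
  L : (T : Finset ι) → (((↥T → X) → ℝ) →ₗ[ℝ] ℝ)
  nonneg : ∀ T : Finset ι, T.card ≤ d → ∀ F : (↥T → X) → ℝ, (∀ b, 0 ≤ F b) → 0 ≤ L T F
  map_one : ∀ T : Finset ι, T.card ≤ d → L T (fun _ => 1) = 1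
  consistent : ∀ ⦃Q T : Finset ι⦄ (h : Q ⊆ T), T.card ≤ d →
    ∀ F : (↥Q → X) → ℝ, L T (fun b => F (Finset.restrict₂ (π := fun _ => X) h b)) = L Q F

section Moebius

variable {ι X : Type*} [Fintype ι] [DecidableEq ι] [Fintype X]

/-! ### Averaging out coordinates and the Möbius components -/

/-- **`A_R f`**: average `f` over the coordinates OUTSIDE `R` (uniformly), keeping `x` on `R`:
`A_R f(x) = E_{y} f(x_R, y_{−R})` — an `R`-junta. [cite: ChanEtAl2016, §2.1 (arXiv v3 p. 8: extension of the functional to all functions)]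
[cite: Lemieux2009, §6.3 (`∫ f du_{−I}`)] -/
def avgOut (R : Finset ι) (f : (ι → X) → ℝ) : (ι → X) → ℝ :=
  fun x => muExpect (uniformWeight ι X) (fun y => f (glue R x y))

/-- **The Möbius component** `f^{(S)} = Σ_{R ⊆ S} (−1)^{|S∖R|} A_R f` (general-alphabet analogue of
the Walsh layer `Σ_{supp = S}`). [cite: Lemieux2009, §6.3 (the ANOVA component)]
[cite: ChanEtAl2016, §3.5 (arXiv v3 p. 11: non-Boolean alphabets)] -/
def moebiusPart (S : Finset ι) (f : (ι → X) → ℝ) : (ι → X) → ℝ :=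
  fun x => ∑ R ∈ S.powerset, (-1 : ℝ) ^ (S \ R).card * avgOut R f x

omit [Fintype ι] [Fintype X] in
/-- The glued point depends on the first argument only through its `R`-coordinates. [folklore] -/
private theorem glue_congr_of_agree {R : Finset ι} {x x' : ι → X} (h : ∀ i ∈ R, x i = x' i) (y : ι → X) :
    glue R x y = glue R x' y := by
  funext i
  by_cases hi : i ∈ R
  · rw [glue_apply_of_mem hi, glue_apply_of_mem hi, h i hi]
  · rw [glue_apply_of_notMem hi, glue_apply_of_notMem hi]

/-- `A_R f` is an `R`-junta. [cite: Lemieux2009, §6.3 ("a function of `u_I` only")] -/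
theorem isSJunta_avgOut (R : Finset ι) (f : (ι → X) → ℝ) : IsSJunta R (avgOut R f) := by
  intro x x' h
  simp only [avgOut]
  congr 1
  funext y
  rw [glue_congr_of_agree h]

/-- For a `T`-junta `f`, `A_T f = f`. [cite: Lemieux2009, §6.3] -/
theorem avgOut_eq_self [Nonempty X] {T : Finset ι} {f : (ι → X) → ℝ} (hf : IsSJunta T f) :
    avgOut T f = f := by
  funext x
  have h : ∀ y, f (glue T x y) = f x := fun y => hf _ _ fun i hi => glue_apply_of_mem hi
  simp only [avgOut, h]
  exact isProbWeight_uniformWeight.muExpect_const (f x)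

/-- If `f` does not depend on the coordinate `i`, averaging it out or not makes no difference:
`A_{R ∪ {i}} f = A_R f`. [cite: Lemieux2009, §6.3] -/
theorem avgOut_insert {T : Finset ι} {f : (ι → X) → ℝ} (hf : IsSJunta T f) {i : ι} (hi : i ∉ T)
    (R : Finset ι) : avgOut (insert i R) f = avgOut R f := by
  funext x
  simp only [avgOut]
  congr 1
  funext y
  refine hf _ _ fun j hj => ?_
  have hji : j ≠ i := fun h => hi (h ▸ hj)
  by_cases hjR : j ∈ R
  · rw [glue_apply_of_mem (mem_insert_of_mem hjR), glue_apply_of_mem hjR]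
  · rw [glue_apply_of_notMem (by simp [hji, hjR]), glue_apply_of_notMem hjR]

/-- `A_R` is additive. [folklore] -/
private theorem avgOut_add (R : Finset ι) (f g : (ι → X) → ℝ) :
    avgOut R (f + g) = avgOut R f + avgOut R g := by
  funext x
  simp only [avgOut, Pi.add_apply]
  exact muExpect_add _ _ _

/-- `A_R` is homogeneous. [folklore] -/
private theorem avgOut_smul (R : Finset ι) (a : ℝ) (f : (ι → X) → ℝ) :
    avgOut R (a • f) = a • avgOut R f := by
  funext x
  simp only [avgOut, Pi.smul_apply, smul_eq_mul]
  exact muExpect_const_mul _ _ _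

/-- The Möbius component is additive. [folklore] -/
private theorem moebiusPart_add (S : Finset ι) (f g : (ι → X) → ℝ) :
    moebiusPart S (f + g) = moebiusPart S f + moebiusPart S g := by
  funext x
  simp only [moebiusPart, avgOut_add, Pi.add_apply, mul_add, sum_add_distrib]

/-- The Möbius component is homogeneous. [folklore] -/
private theorem moebiusPart_smul (S : Finset ι) (a : ℝ) (f : (ι → X) → ℝ) :
    moebiusPart S (a • f) = a • moebiusPart S f := by
  funext x
  simp only [moebiusPart, avgOut_smul, Pi.smul_apply, smul_eq_mul, mul_sum]
  refine sum_congr rfl fun R _ => ?_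
  ring

/-- `f^{(S)}` is an `S`-junta. [cite: Lemieux2009, §6.3 (`f_I` depends on `u_I` only)] -/
theorem isSJunta_moebiusPart (S : Finset ι) (f : (ι → X) → ℝ) : IsSJunta S (moebiusPart S f) := by
  intro x x' h
  simp only [moebiusPart]
  refine sum_congr rfl fun R hR => ?_
  rw [isSJunta_avgOut R f x x' fun i hi => h i (mem_powerset.1 hR hi)]

/-- **Vanishing of the components off the support of a junta** (insert form): if `f` is a `T`-junta,
`i ∉ T` and `i ∉ S'`, then `f^{(S' ∪ {i})} = 0` — the terms `R` and `R ∪ {i}` cancel.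
[cite: Lemieux2009, §6.3] [cite: ChanEtAl2016, §2.1 (arXiv v3 p. 8: the coefficients of a junta off its support vanish)] -/
theorem moebiusPart_insert_eq_zero {T : Finset ι} {f : (ι → X) → ℝ} (hf : IsSJunta T f) {i : ι}
    (hiT : i ∉ T) {S' : Finset ι} (hiS : i ∉ S') : moebiusPart (insert i S') f = 0 := by
  funext x
  simp only [moebiusPart, Pi.zero_apply]
  rw [sum_powerset_insert hiS, ← sum_add_distrib]
  refine sum_eq_zero fun R hR => ?_
  have hRS : R ⊆ S' := mem_powerset.1 hR
  have hiR : i ∉ R := fun h => hiS (hRS h)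
  have h1 : insert i S' \ R = insert i (S' \ R) := insert_sdiff_of_notMem S' hiR
  have h2 : insert i S' \ insert i R = S' \ R := by
    rw [insert_sdiff_insert]
    exact sdiff_insert_of_notMem hiS R
  have hcard : (insert i (S' \ R)).card = (S' \ R).card + 1 :=
    card_insert_of_notMem fun h => hiS (mem_sdiff.1 h).1
  rw [h1, h2, hcard, avgOut_insert hf hiT R, pow_succ]
  ring

/-- **Vanishing of the components off the support of a junta**: `f` a `T`-junta and `S ⊄ T` imply
`f^{(S)} = 0`. [cite: Lemieux2009, §6.3] [cite: ChanEtAl2016, §2.1 (arXiv v3 p. 8)] -/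
theorem moebiusPart_eq_zero {T : Finset ι} {f : (ι → X) → ℝ} (hf : IsSJunta T f) {S : Finset ι}
    (hS : ¬ S ⊆ T) : moebiusPart S f = 0 := by
  obtain ⟨i, hiS, hiT⟩ := not_subset.1 hS
  have h := moebiusPart_insert_eq_zero hf hiT (S' := S.erase i) (notMem_erase i S)
  rwa [insert_erase hiS] at h

/-- Möbius inversion on the Boolean lattice, inner sum: for `w ⊆ u`,
`Σ_{w ⊆ v ⊆ u} (-1)^{|v \ w|} = [w = u]` (as in the tree's ANOVA file). [folklore] -/
private theorem sum_neg_one_pow_card_sdiff' {u w : Finset ι} (hw : w ⊆ u) :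
    ∑ v ∈ u.powerset with w ⊆ v, (-1 : ℝ) ^ (v \ w).card = if w = u then 1 else 0 := by
  have h1 : ∑ v ∈ u.powerset with w ⊆ v, (-1 : ℝ) ^ (v \ w).card =
      ∑ t ∈ (u \ w).powerset, (-1 : ℝ) ^ t.card := by
    refine sum_nbij' (fun v => v \ w) (fun t => w ∪ t) ?_ ?_ ?_ ?_ ?_
    · intro v hv
      simp only [mem_filter, mem_powerset] at hv
      exact mem_powerset.2 (sdiff_subset_sdiff hv.1 subset_rfl)
    · intro t ht
      have ht' : t ⊆ u \ w := mem_powerset.1 ht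
      simp only [mem_filter, mem_powerset]
      exact ⟨union_subset hw (ht'.trans sdiff_subset), subset_union_left⟩
    · intro v hv
      simp only [mem_filter, mem_powerset] at hv
      exact union_sdiff_of_subset hv.2
    · intro t ht
      have ht' : t ⊆ u \ w := mem_powerset.1 ht
      exact union_sdiff_cancel_left (disjoint_sdiff.mono_right ht')
    · intro v _; rfl
  have h2 : ∑ t ∈ (u \ w).powerset, (-1 : ℝ) ^ t.card = if u \ w = ∅ then 1 else 0 := by
    exact_mod_cast (sum_powerset_neg_one_pow_card (x := u \ w))
  rw [h1, h2]
  by_cases hwu : w = u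
  · simp [hwu]
  · have : u \ w ≠ ∅ := by
      rw [Ne, sdiff_eq_empty_iff_subset]
      exact fun h => hwu (subset_antisymm hw h)
    simp [hwu, this]

/-- Möbius inversion on the Boolean lattice: `Σ_{v ⊆ u} Σ_{w ⊆ v} (-1)^{|v \ w|} g(w) = g(u)` (as in the
tree's ANOVA file). [folklore] -/
private theorem sum_powerset_sum_powerset_moebius' (u : Finset ι) (g : Finset ι → ℝ) :
    ∑ v ∈ u.powerset, ∑ w ∈ v.powerset, (-1 : ℝ) ^ (v \ w).card * g w = g u := by
  calc ∑ v ∈ u.powerset, ∑ w ∈ v.powerset, (-1 : ℝ) ^ (v \ w).card * g w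
      = ∑ w ∈ u.powerset, ∑ v ∈ u.powerset with w ⊆ v, (-1 : ℝ) ^ (v \ w).card * g w := by
        refine sum_comm' fun v w => ?_
        simp only [mem_powerset, mem_filter]
        exact ⟨fun ⟨h1, h2⟩ => ⟨⟨h1, h2⟩, h2.trans h1⟩, fun ⟨⟨h1, h2⟩, _⟩ => ⟨h1, h2⟩⟩
    _ = ∑ w ∈ u.powerset, (∑ v ∈ u.powerset with w ⊆ v, (-1 : ℝ) ^ (v \ w).card) * g w := by
        simp_rw [sum_mul]
    _ = ∑ w ∈ u.powerset, (if w = u then 1 else 0 : ℝ) * g w :=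
        sum_congr rfl fun w hw => by rw [sum_neg_one_pow_card_sdiff' (mem_powerset.1 hw)]
    _ = g u := by simp

/-- **Möbius inversion: `Σ_{S ⊆ T} f^{(S)} = A_T f`** (the components below `T` sum to the average
over the coordinates outside `T`; for a `T`-junta this is `f` itself).
[cite: Lemieux2009, §6.3 (`Σ_{J ⊆ I} f_J = ∫ f du_{−I}`)] -/
theorem sum_powerset_moebiusPart (T : Finset ι) (f : (ι → X) → ℝ) (x : ι → X) :
    ∑ S ∈ T.powerset, moebiusPart S f x = avgOut T f x :=
  sum_powerset_sum_powerset_moebius' T fun R => avgOut R f x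

/-! ### The Sherali–Adams functional and the pseudo-density of a consistent family -/

/-- Extension of a local assignment `b ∈ X^T` to `X^ι` by a default letter `x₀` off `T`.
[cite: CharikarMakarychevMakarychev2009, Lemma 2.1 (p. 4–5)] -/
def extendWith (x₀ : X) (T : Finset ι) (b : ↥T → X) : ι → X :=
  fun i => if h : i ∈ T then b ⟨i, h⟩ else x₀

omit [Fintype ι] [Fintype X] in
/-- On `T` the extension is `b`. [cite: CharikarMakarychevMakarychev2009, Lemma 2.1 (p. 4–5)] -/
@[simp] theorem extendWith_apply_mem (x₀ : X) (T : Finset ι) (b : ↥T → X) (i : ↥T) :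
    extendWith x₀ T b i = b i := by
  simp [extendWith, i.2]

namespace LocalExpectationsOn

variable {d : ℕ} (ℒ : LocalExpectationsOn ι X d) (x₀ : X)

/-- **The Sherali–Adams functional of a consistent family over `X`:**
`Ẽ f = Σ_{|S| ≤ d} L_S(f^{(S)}|_S)` (each Möbius component, an `S`-junta, is read on the local
assignments of `S` and fed to the local expectation `L_S`).
[cite: ChanEtAl2016, §2.1 (arXiv v3 p. 8: "we can extend it linearly to all of L²")]
[cite: CharikarMakarychevMakarychev2009, Lemma 2.1 (p. 4–5)] -/
def saE : ((ι → X) → ℝ) →ₗ[ℝ] ℝ where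
  toFun f := ∑ S ∈ univ.filter (fun S : Finset ι => S.card ≤ d),
    ℒ.L S (fun b => moebiusPart S f (extendWith x₀ S b))
  map_add' f g := by
    rw [← sum_add_distrib]
    refine sum_congr rfl fun S _ => ?_
    rw [← map_add]
    congr 1
    funext b
    simp [moebiusPart_add]
  map_smul' a f := by
    rw [RingHom.id_apply, smul_eq_mul, mul_sum]
    refine sum_congr rfl fun S _ => ?_
    rw [← smul_eq_mul, ← map_smul]
    congr 1
    funext b
    simp [moebiusPart_smul]

/-- Unfolding `saE`. [cite: ChanEtAl2016, §2.1 (arXiv v3 p. 8)] -/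
theorem saE_apply (f : (ι → X) → ℝ) :
    ℒ.saE x₀ f = ∑ S ∈ univ.filter (fun S : Finset ι => S.card ≤ d),
      ℒ.L S (fun b => moebiusPart S f (extendWith x₀ S b)) := rfl

/-- **The key identity: on a `T`-junta (`|T| ≤ d`) the Sherali–Adams functional is the local
expectation**, `Ẽ f = L_T(f|_T) = E_{D_T} f`.  Proof: components with `S ⊄ T` vanish; for `S ⊆ T`
consistency gives `L_S(f^{(S)}|_S) = L_T(f^{(S)}|_T)`; and `Σ_{S ⊆ T} f^{(S)} = A_T f = f`.
[cite: CharikarMakarychevMakarychev2009, Lemma 2.1 (p. 4–5)] [cite: ChanEtAl2016, §2.1 (arXiv v3 p. 8)] -/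
theorem saE_eq_of_isSJunta [Nonempty X] {T : Finset ι} (hT : T.card ≤ d) {f : (ι → X) → ℝ}
    (hf : IsSJunta T f) : ℒ.saE x₀ f = ℒ.L T (fun b => f (extendWith x₀ T b)) := by
  -- (1) restrict the sum to the subsets of `T`
  have h1 : ℒ.saE x₀ f = ∑ S ∈ T.powerset, ℒ.L S (fun b => moebiusPart S f (extendWith x₀ S b)) := by
    rw [saE_apply]
    symm
    refine sum_subset ?_ ?_
    · intro S hS
      exact mem_filter.2 ⟨mem_univ _, (card_le_card (mem_powerset.1 hS)).trans hT⟩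
    · intro S _ hS
      rw [mem_powerset] at hS
      have h0 : (fun b : ↥S → X => moebiusPart S f (extendWith x₀ S b)) = 0 := by
        funext b
        rw [moebiusPart_eq_zero hf hS]
        rfl
      rw [h0, map_zero]
  -- (2) move every `L_S`, `S ⊆ T`, up to `L_T` by consistency
  have h2 : ∀ S ∈ T.powerset, ℒ.L S (fun b => moebiusPart S f (extendWith x₀ S b)) =
      ℒ.L T (fun b => moebiusPart S f (extendWith x₀ T b)) := by
    intro S hS
    have hST : S ⊆ T := mem_powerset.1 hS
    rw [← ℒ.consistent hST hT]
    congr 1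
    funext b
    refine isSJunta_moebiusPart S f _ _ fun i hi => ?_
    rw [show extendWith x₀ T b i = b ⟨i, hST hi⟩ from extendWith_apply_mem x₀ T b ⟨i, hST hi⟩]
    rw [show extendWith x₀ S (Finset.restrict₂ (π := fun _ => X) hST b) i =
      Finset.restrict₂ (π := fun _ => X) hST b ⟨i, hi⟩ from extendWith_apply_mem x₀ S _ ⟨i, hi⟩]
    rfl
  rw [h1, sum_congr rfl h2, ← map_sum]
  congr 1
  funext b
  rw [Finset.sum_apply, sum_powerset_moebiusPart, avgOut_eq_self hf]

variable [DecidableEq X]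

/-- **The pseudo-density of the family**: `D(x) = |X^ι| · Ẽ(𝟙_{x})`, the Riesz representer of `Ẽ`
w.r.t. the uniform measure. [cite: LeeRaghavendraSteurer2015, §7.1 (arXiv p. 27: d-local pseudo-density)]
[cite: ChanEtAl2016, §2.1 (arXiv v3 p. 8: "using self-duality of L² we may also think of Ẽ ∈ L²")] -/
def density : (ι → X) → ℝ :=
  fun x => Fintype.card (ι → X) * ℒ.saE x₀ (fun y => if y = x then 1 else 0)

/-- **`E_x[D(x) g(x)] = Ẽ g`** for every `g` (uniform measure). [cite: ChanEtAl2016, §2.1 (arXiv v3 p. 8)] -/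
theorem muExpect_density_mul (g : (ι → X) → ℝ) :
    muExpect (uniformWeight ι X) (fun x => ℒ.density x₀ x * g x) = ℒ.saE x₀ g := by
  have hcard : (0 : ℝ) < Fintype.card (ι → X) := by
    have : 0 < Fintype.card (ι → X) := Fintype.card_pos_iff.mpr ⟨fun _ => x₀⟩
    exact_mod_cast this
  have hg : g = ∑ x : ι → X, g x • (fun y => if y = x then (1 : ℝ) else 0) := by
    funext y
    rw [Finset.sum_apply]
    simp only [Pi.smul_apply, smul_eq_mul, mul_ite, mul_one, mul_zero]
    rw [Finset.sum_ite_eq]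
    simp
  conv_rhs => rw [hg, map_sum]
  simp only [map_smul, smul_eq_mul, muExpect, density, uniformWeight]
  refine sum_congr rfl fun x _ => ?_
  field_simp

/-- **`E_x[D(x) g(x)] = L_T(g|_T) = E_{D_T} g`** for every `T`-junta `g` with `|T| ≤ d`: the
pseudo-density reproduces the local distributions. [cite: CharikarMakarychevMakarychev2009, Lemma 2.1 (p. 4–5)] -/
theorem muExpect_density_mul_of_isSJunta {T : Finset ι} (hT : T.card ≤ d) {g : (ι → X) → ℝ}
    (hg : IsSJunta T g) :
    muExpect (uniformWeight ι X) (fun x => ℒ.density x₀ x * g x) =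
      ℒ.L T (fun b => g (extendWith x₀ T b)) := by
  haveI : Nonempty X := ⟨x₀⟩
  rw [muExpect_density_mul, saE_eq_of_isSJunta ℒ x₀ hT hg]

/-- **CMM Lemma 2.1 / CLRS §2.1 over a general alphabet, in Lee–Raghavendra–Steurer's currency: the
pseudo-density of a consistent family of local distributions on the sets of size `≤ d` is a `d`-local
pseudo-density w.r.t. the uniform measure** (`E D = 1`, `E[D g] ≥ 0` for every nonnegative
`d`-junta `g`). [cite: CharikarMakarychevMakarychev2009, Lemma 2.1 (p. 4–5)]
[cite: LeeRaghavendraSteurer2015, §7.1 (arXiv p. 27) and Thm 7.6 (p. 29: "equivalence between such lower bounds and the existence of a d-local pseudo-density")] -/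
theorem isLocalPseudoDensity_density :
    IsLocalPseudoDensity (uniformWeight ι X) d (ℒ.density x₀) := by
  refine ⟨?_, fun g hg hg0 => ?_⟩
  · have h := ℒ.muExpect_density_mul_of_isSJunta x₀ (T := ∅) (by simp) (g := fun _ => (1 : ℝ))
      (isSJunta_const ∅ 1)
    simp only [mul_one] at h
    rw [show (fun x => ℒ.density x₀ x) = ℒ.density x₀ from rfl] at h
    rw [h]
    exact ℒ.map_one ∅ (by simp)
  · obtain ⟨T, hT, hgT⟩ := hg
    rw [ℒ.muExpect_density_mul_of_isSJunta x₀ hT hgT]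
    exact ℒ.nonneg T hT _ fun b => hg0 _

end LocalExpectationsOn

end Moebius

end Literature.Combinatorics.Optimization
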